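import Literature.NumberTheory.Sieve.Maynard2016CoupledLocal
import Literature.NumberTheory.Sieve.Maynard2016CoupledBox
import Literature.NumberTheory.Sieve.Maynard2016BadPrimes

/-!
# Maynard (2016), Lemma 6: `∏_p K_p ≪ (log x)^{O_k(1)}` (the crude polylogarithmic bound after (6.11))

Trunk: AntSieve / parity (Maynard 2016 large-gaps ladder, named fact
`Literature.NumberTheory.Sieve.Maynard2016.Lemma6MainTerm` of `Maynard2016Lemma6Split.lean`).

J. Maynard, *Large gaps between primes*, Ann. of Math. 183 (2016) = arXiv:1408.5110, §6, proof of
Lemma 6, after display (6.11): "we see that `K_p = 1 + O_k(p^{−1−1/log x})`", so that "the product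
`∏_p K_p` converges absolutely" and is "`≪ (log x)^{O_k(1)}`" — the crude bound which, together with
the rapid decay of the Fourier weights `f, g`, makes the contribution of the frequencies outside the
cube `|ξ|, |ξ'|, |τ|, |τ'| ≤ √log x` negligible.  The tree's `LcmEuler.norm_coupledKernel_le`
(`Maynard2016CoupledKernel`) bounds `‖K‖` by `exp(C Σ_n n^{−1−σ}) = e^{O(1/σ)}`, which is only
`x^{O(1)}`; here we PROVE the polylogarithmic form
* `norm_coupledLocalFactorMu_sub_one_le` — `|K_p − 1| ≤ (3k₁ + 3k₂ + 9k₁k₂) p^{−1−σ}`,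
* `norm_coupledKernel_le_zetaR_pow` — **`‖K‖ ≤ ζ(1+σ)^{3k₁+3k₂+9k₁k₂}`** (via `∏_p (1 + p^{−s}) ≤ ζ(s)`,
  `LcmEuler.prod_one_add_le_zetaR`), and for Maynard's data (`σ = 1/log x`, `ζ(1+1/log x) ≤ 2 log x`)
* `Maynard2016.eventually_norm_logpow_mul_kernel_le` — **`‖(log x)^k (log y)^k K(ξ,ξ',τ,τ')‖ ≤
  2^{15k²} (log x)^{15k²+2k}`** for all large `x`, all `m`, all coupling data and all frequencies.

## References

* J. Maynard, *Large gaps between primes*, Ann. of Math. (2) 183 (2016), 915–933; arXiv:1408.5110,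
  §6, proof of Lemma 6, display (6.11) and the sentence following it. [Maynard2016LargeGaps]
* D. H. J. Polymath, *Variants of the Selberg sieve, and bounded intervals containing many primes*,
  Res. Math. Sci. 1 (2014), Art. 12; arXiv:1407.4897, proof of Lemma 4.1, p. 12
  ("`K = O(log^{3k} x)`"). [Polymath8b2014]
-/

noncomputable section

open Filter Finset
open scoped BigOperators Topology

namespace Literature.NumberTheory.Sieve

namespace LcmEuler

variable {ι κ : Type*} [Fintype ι] [DecidableEq ι] [Fintype κ] [DecidableEq κ]

/-! ### `|σ_i(p)| ≤ 3 p^{−σ}` and `|K_p − 1| ≤ C p^{−1−σ}` -/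

omit [Fintype ι] [DecidableEq ι] [Fintype κ] [DecidableEq κ] in
/-- `|p^{−a}| ≤ p^{−σ} ≤ 1` for `Re a ≥ σ ≥ 0`. [folklore] -/
private theorem norm_cpow_neg_le_rpow {q : ℕ} (hq : 0 < q) {a : ℂ} {σ : ℝ} (hσ : 0 ≤ σ)
    (ha : σ ≤ a.re) : ‖(q : ℂ) ^ (-a)‖ ≤ (q : ℝ) ^ (-σ) ∧ (q : ℝ) ^ (-σ) ≤ 1 := by
  have hq1 : (1 : ℝ) ≤ q := by exact_mod_cast hq
  rw [Complex.norm_natCast_cpow_of_pos hq, Complex.neg_re]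
  exact ⟨Real.rpow_le_rpow_of_exponent_le hq1 (neg_le_neg ha),
    Real.rpow_le_one_of_one_le_of_nonpos hq1 (by linarith)⟩

omit [Fintype ι] [DecidableEq ι] [Fintype κ] [DecidableEq κ] in
/-- **`|σ_i(p)| ≤ 3 p^{−σ}`** when `Re a_i, Re b_i ≥ σ ≥ 0`. [cite: Maynard2016LargeGaps, §6 display (6.11)] -/
theorem norm_muSlot_le_rpow {α : Type*} {a b : α → ℂ} {q : ℕ} (hq : 0 < q) {σ : ℝ} (hσ : 0 ≤ σ)
    {i : α} (ha : σ ≤ (a i).re) (hb : σ ≤ (b i).re) : ‖muSlot a b q i‖ ≤ 3 * (q : ℝ) ^ (-σ) := by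
  obtain ⟨hu, hu1⟩ := norm_cpow_neg_le_rpow hq hσ ha
  obtain ⟨hv, -⟩ := norm_cpow_neg_le_rpow hq hσ hb
  have h0 : 0 ≤ (q : ℝ) ^ (-σ) := Real.rpow_nonneg (Nat.cast_nonneg q) _
  unfold muSlot
  calc ‖(q : ℂ) ^ (-a i) * (q : ℂ) ^ (-b i) - (q : ℂ) ^ (-a i) - (q : ℂ) ^ (-b i)‖
      ≤ ‖(q : ℂ) ^ (-a i) * (q : ℂ) ^ (-b i)‖ + ‖(q : ℂ) ^ (-a i)‖ + ‖(q : ℂ) ^ (-b i)‖ :=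
        (norm_sub_le _ _).trans (add_le_add (norm_sub_le _ _) le_rfl)
    _ ≤ (q : ℝ) ^ (-σ) * 1 + (q : ℝ) ^ (-σ) + (q : ℝ) ^ (-σ) := by
        rw [norm_mul]
        have hv1 : ‖(q : ℂ) ^ (-b i)‖ ≤ 1 := hv.trans hu1
        gcongr
    _ = 3 * (q : ℝ) ^ (-σ) := by ring

/-- The exponent `C = 3k₁ + 3k₂ + 9k₁k₂` of the crude bound. [cite: Maynard2016LargeGaps, §6 display (6.11)] -/
def crudeExp (k₁ k₂ : ℕ) : ℕ := 3 * k₁ + 3 * k₂ + 9 * k₁ * k₂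

omit [DecidableEq ι] [DecidableEq κ] in
/-- **`K_p = 1 + O_k(p^{−1−σ})`**: `|K_p − 1| ≤ (3k₁ + 3k₂ + 9k₁k₂) p^{−1−σ}` for a prime `p` when all
exponents have real part `≥ σ ≥ 0`. [cite: Maynard2016LargeGaps, §6 display (6.11)] -/
theorem norm_coupledLocalFactorMu_sub_one_le (m : ℕ) (M : ℕ → Finset (ι × κ)) {a b : ι → ℂ}
    {a' b' : κ → ℂ} {σ : ℝ} (hσ : 0 ≤ σ) (hab : ∀ i, σ ≤ (a i).re ∧ σ ≤ (b i).re)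
    (hab' : ∀ j, σ ≤ (a' j).re ∧ σ ≤ (b' j).re) {q : ℕ} (hq : q.Prime) :
    ‖coupledLocalFactorMu m M a b a' b' q - 1‖ ≤
      (crudeExp (Fintype.card ι) (Fintype.card κ) : ℝ) * (q : ℝ) ^ (-(1 + σ)) := by
  have hq0 : 0 < q := hq.pos
  have hqr : (0 : ℝ) < q := by exact_mod_cast hq0
  have hA : ∀ i, ‖muSlot a b q i‖ ≤ 3 * (q : ℝ) ^ (-σ) := fun i =>
    norm_muSlot_le_rpow hq0 hσ (hab i).1 (hab i).2
  have hB : ∀ j, ‖muSlot a' b' q j‖ ≤ 3 * (q : ℝ) ^ (-σ) := fun j =>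
    norm_muSlot_le_rpow hq0 hσ (hab' j).1 (hab' j).2
  have h0 : 0 ≤ (q : ℝ) ^ (-σ) := Real.rpow_nonneg (Nat.cast_nonneg q) _
  have h1 : (q : ℝ) ^ (-σ) ≤ 1 :=
    Real.rpow_le_one_of_one_le_of_nonpos (by exact_mod_cast hq0) (by linarith)
  have hSA : ‖∑ i, muSlot a b q i‖ ≤ Fintype.card ι * (3 * (q : ℝ) ^ (-σ)) := by
    refine (norm_sum_le _ _).trans ?_
    calc _ ≤ ∑ _i : ι, 3 * (q : ℝ) ^ (-σ) := Finset.sum_le_sum fun i _ => hA i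
      _ = _ := by rw [Finset.sum_const, Finset.card_univ, nsmul_eq_mul]
  have hSB : ‖∑ j, muSlot a' b' q j‖ ≤ Fintype.card κ * (3 * (q : ℝ) ^ (-σ)) := by
    refine (norm_sum_le _ _).trans ?_
    calc _ ≤ ∑ _j : κ, 3 * (q : ℝ) ^ (-σ) := Finset.sum_le_sum fun j _ => hB j
      _ = _ := by rw [Finset.sum_const, Finset.card_univ, nsmul_eq_mul]
  have hSC : ‖couplingSum M a b a' b' q‖ ≤ (Fintype.card ι * Fintype.card κ) * (9 * (q : ℝ) ^ (-σ)) := by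
    unfold couplingSum
    refine (norm_sum_le _ _).trans ?_
    have hle : ∀ p ∈ M q, ‖muSlot a b q p.1 * muSlot a' b' q p.2‖ ≤ 9 * (q : ℝ) ^ (-σ) := by
      intro p _
      rw [norm_mul]
      calc ‖muSlot a b q p.1‖ * ‖muSlot a' b' q p.2‖ ≤ (3 * (q : ℝ) ^ (-σ)) * (3 * (q : ℝ) ^ (-σ)) :=
            mul_le_mul (hA p.1) (hB p.2) (norm_nonneg _) (by positivity)
        _ = 9 * (q : ℝ) ^ (-σ) * (q : ℝ) ^ (-σ) := by ring
        _ ≤ 9 * (q : ℝ) ^ (-σ) * 1 := by gcongr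
        _ = _ := by ring
    calc ∑ p ∈ M q, ‖muSlot a b q p.1 * muSlot a' b' q p.2‖ ≤ ∑ _p ∈ M q, 9 * (q : ℝ) ^ (-σ) :=
          Finset.sum_le_sum hle
      _ = (M q).card * (9 * (q : ℝ) ^ (-σ)) := by rw [Finset.sum_const, nsmul_eq_mul]
      _ ≤ _ := by
          gcongr
          calc ((M q).card : ℝ) ≤ (Finset.univ : Finset (ι × κ)).card := by
                exact_mod_cast Finset.card_le_univ _
            _ = Fintype.card ι * Fintype.card κ := by
                rw [Finset.card_univ, Fintype.card_prod]; push_cast; ring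
  rw [coupledLocalFactorMu_eq m M a b a' b' hq, add_sub_cancel_left, norm_div,
    Complex.norm_natCast]
  have hsplit : (q : ℝ) ^ (-(1 + σ)) = (q : ℝ) ^ (-σ) / q := by
    rw [neg_add, Real.rpow_add hqr, Real.rpow_neg_one, div_eq_mul_inv]; ring
  rw [hsplit, ← mul_div_assoc, div_le_div_iff_of_pos_right hqr]
  have hnum : ‖(∑ i, muSlot a b q i) +
      (if q ∣ m then 0 else (∑ j, muSlot a' b' q j) + couplingSum M a b a' b' q)‖ ≤
      Fintype.card ι * (3 * (q : ℝ) ^ (-σ)) + (Fintype.card κ * (3 * (q : ℝ) ^ (-σ)) +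
        (Fintype.card ι * Fintype.card κ) * (9 * (q : ℝ) ^ (-σ))) := by
    refine (norm_add_le _ _).trans (add_le_add hSA ?_)
    split_ifs
    · rw [norm_zero]; positivity
    · exact (norm_add_le _ _).trans (add_le_add hSB hSC)
  refine hnum.trans (le_of_eq ?_)
  unfold crudeExp; push_cast; ring

/-! ### `‖∏_p K_p‖ ≤ ζ(1+σ)^C` and `‖K‖ ≤ ζ(1+σ)^C` -/

omit [DecidableEq ι] [DecidableEq κ] in
/-- `‖∏_{p ∈ P} K_p‖ ≤ ζ(1+σ)^{C}` for a finite set of primes `P` (`σ > 0`).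
[cite: Maynard2016LargeGaps, §6 display (6.11)] -/
theorem norm_prod_coupledLocalFactorMu_le (m : ℕ) (M : ℕ → Finset (ι × κ)) {a b : ι → ℂ}
    {a' b' : κ → ℂ} {σ : ℝ} (hσ : 0 < σ) (hab : ∀ i, σ ≤ (a i).re ∧ σ ≤ (b i).re)
    (hab' : ∀ j, σ ≤ (a' j).re ∧ σ ≤ (b' j).re) {P : Finset ℕ} (hP : ∀ q ∈ P, q.Prime) :
    ‖∏ q ∈ P, coupledLocalFactorMu m M a b a' b' q‖ ≤
      zetaR (1 + σ) ^ crudeExp (Fintype.card ι) (Fintype.card κ) := by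
  set C := crudeExp (Fintype.card ι) (Fintype.card κ) with hC
  have hfac : ∀ q ∈ P, ‖coupledLocalFactorMu m M a b a' b' q‖ ≤ (1 + (q : ℝ) ^ (-(1 + σ))) ^ C := by
    intro q hq
    have h1 := norm_coupledLocalFactorMu_sub_one_le m M hσ.le hab hab' (hP q hq)
    have h2 : ‖coupledLocalFactorMu m M a b a' b' q‖ ≤ 1 + (C : ℝ) * (q : ℝ) ^ (-(1 + σ)) := by
      have := norm_le_norm_add_norm_sub' (coupledLocalFactorMu m M a b a' b' q) 1
      rw [norm_one] at this; linarith
    refine h2.trans ?_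
    have h0 : 0 ≤ (q : ℝ) ^ (-(1 + σ)) := Real.rpow_nonneg (Nat.cast_nonneg q) _
    exact one_add_mul_le_pow (by linarith) C
  calc ‖∏ q ∈ P, coupledLocalFactorMu m M a b a' b' q‖ = ∏ q ∈ P, ‖coupledLocalFactorMu m M a b a' b' q‖ :=
        norm_prod _ _
    _ ≤ ∏ q ∈ P, (1 + (q : ℝ) ^ (-(1 + σ))) ^ C := Finset.prod_le_prod (fun _ _ => norm_nonneg _) hfac
    _ = (∏ q ∈ P, (1 + (q : ℝ) ^ (-(1 + σ)))) ^ C := Finset.prod_pow _ _ _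
    _ ≤ zetaR (1 + σ) ^ C :=
        pow_le_pow_left₀ (Finset.prod_nonneg fun q _ => by positivity)
          (prod_one_add_le_zetaR (by linarith) hP) C

omit [DecidableEq ι] [DecidableEq κ] in
/-- **`∏_p K_p ≪ (log x)^{O_k(1)}`**, in the form `‖K‖ ≤ ζ(1+σ)^{3k₁+3k₂+9k₁k₂}` (`σ > 0` a common
lower bound for the real parts of the exponents). [cite: Maynard2016LargeGaps, §6 display (6.11)] -/
theorem norm_coupledKernel_le_zetaR_pow {W : ℕ} (m : ℕ) (M : ℕ → Finset (ι × κ)) {a b : ι → ℂ}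
    {a' b' : κ → ℂ} {σ : ℝ} (hσ : 0 < σ) (hab : ∀ i, σ ≤ (a i).re ∧ σ ≤ (b i).re)
    (hab' : ∀ j, σ ≤ (a' j).re ∧ σ ≤ (b' j).re) :
    ‖coupledKernel W m M a b a' b'‖ ≤ zetaR (1 + σ) ^ crudeExp (Fintype.card ι) (Fintype.card κ) := by
  classical
  refine le_of_tendsto' ((continuous_norm.tendsto _).comp
    (tendsto_prod_coupledLocalFactorMu (W := W) (m := m) M hσ hab hab')) fun N => ?_
  exact norm_prod_coupledLocalFactorMu_le m M hσ hab hab' fun q hq => prime_of_mem_primesBelowNotDvd hq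

end LcmEuler

/-! ### Maynard's data: `‖(log x)^k (log y)^k K‖ ≤ 2^{15k²} (log x)^{15k²+2k}` -/

namespace Maynard2016

open LcmEuler

/-- **The crude bound for Maynard's coupled kernel**: eventually in `x : ℕ`, for ALL `m`, all
coupling data `M`, all `1 < y' ≤ x` and all frequencies,
`‖(log x)^k (log y')^k K(ξ,ξ',τ,τ')‖ ≤ (2 log x)^{15k²} (log x)^{2k}` (`K = coupledFreqKernel (P_w) m M x y'`;
`3k + 3k + 9k² ≤ 15k²` for `k ≥ 1`, and `ζ(1 + 1/log x) ≤ 2 log x`).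
[cite: Maynard2016LargeGaps, §6 display (6.11)] -/
theorem eventually_norm_logpow_mul_kernel_le (k : ℕ) :
    ∀ᶠ x : ℕ in atTop, ∀ (m : ℕ) (M : ℕ → Finset (Fin k × Fin k)) (y' : ℝ), 1 < y' → y' ≤ x →
      ∀ p : (Fin k → ℝ × ℝ) × (Fin k → ℝ × ℝ),
        ‖(Real.log x : ℂ) ^ k * (Real.log y' : ℂ) ^ k * coupledFreqKernel (Pw x) m M (x : ℝ) y' p‖ ≤
          (2 * Real.log x) ^ crudeExp k k * (Real.log x) ^ (2 * k) := by
  obtain ⟨δ₀, hδ₀, hζ⟩ := exists_delta_zetaR_le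
  have hT : Tendsto (fun x : ℕ => Real.log (x : ℝ)) atTop atTop :=
    Real.tendsto_log_atTop.comp tendsto_natCast_atTop_atTop
  filter_upwards [eventually_gt_atTop 1,
    (tendsto_inv_atTop_zero.comp hT).eventually_lt_const hδ₀] with x hx hσδ
  intro m M y' hy1 hyx p
  have hx1 : (1 : ℝ) < x := by exact_mod_cast hx
  have hL : 0 < Real.log x := Real.log_pos hx1
  have hly : 0 < Real.log y' := Real.log_pos hy1
  have hlyx : Real.log y' ≤ Real.log x := Real.log_le_log (by linarith) hyx
  set σ : ℝ := 1 / Real.log x with hσ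
  have hσ0 : 0 < σ := by positivity
  have hσδ' : σ < δ₀ := by rw [hσ, one_div]; exact hσδ
  have habσ : ∀ i, σ ≤ (expA (x : ℝ) p.1 i).re ∧ σ ≤ (expB (x : ℝ) p.1 i).re := fun i => by
    rw [(expA_re_expB_re (x : ℝ) p.1 i).1, (expA_re_expB_re (x : ℝ) p.1 i).2]
    exact ⟨hσ.le, hσ.le⟩
  have hab'σ : ∀ j, σ ≤ (expA y' p.2 j).re ∧ σ ≤ (expB y' p.2 j).re := fun j => by
    rw [(expA_re_expB_re y' p.2 j).1, (expA_re_expB_re y' p.2 j).2, hσ]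
    exact ⟨one_div_le_one_div_of_le hly hlyx, one_div_le_one_div_of_le hly hlyx⟩
  have hK : ‖coupledFreqKernel (Pw x) m M (x : ℝ) y' p‖ ≤ zetaR (1 + σ) ^ crudeExp k k := by
    have h := norm_coupledKernel_le_zetaR_pow (W := Pw x) m M hσ0 habσ hab'σ
    rw [Fintype.card_fin] at h
    exact h
  have hz : zetaR (1 + σ) ≤ 2 * Real.log x := by
    have h := hζ σ hσ0 hσδ'
    have e : (2 : ℝ) / σ = 2 * Real.log x := by rw [hσ]; field_simp
    rwa [e] at h
  have hz0 : 0 ≤ zetaR (1 + σ) := zetaR_nonneg _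
  rw [norm_mul, norm_mul, norm_pow, norm_pow, Complex.norm_real, Complex.norm_real,
    Real.norm_eq_abs, Real.norm_eq_abs, abs_of_pos hL, abs_of_pos hly]
  calc Real.log x ^ k * Real.log y' ^ k * ‖coupledFreqKernel (Pw x) m M (x : ℝ) y' p‖
      ≤ Real.log x ^ k * Real.log x ^ k * zetaR (1 + σ) ^ crudeExp k k := by
        refine mul_le_mul (mul_le_mul_of_nonneg_left (pow_le_pow_left₀ hly.le hlyx k) (by positivity))
          hK (norm_nonneg _) (by positivity)
    _ ≤ Real.log x ^ k * Real.log x ^ k * (2 * Real.log x) ^ crudeExp k k := by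
        gcongr
    _ = (2 * Real.log x) ^ crudeExp k k * Real.log x ^ (2 * k) := by ring

end Maynard2016

end Literature.NumberTheory.Sieve

end
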